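import Summits.BirchSwinnertonDyer.BirchSwinnertonDyer.Theorems.SignedLowerHalvesSmallImageLowerHalfBothSignsRttLayerLawUndepletedK
import Summits.BirchSwinnertonDyer.BirchSwinnertonDyer.Theorems.SignedLowerHalvesSmallImageLowerHalfBothSignsRttEulerLayerK
import HarnessLib

/-!
# Route `SignedLowerHalves`, crux L `SmallImageLowerHalfBothSigns` (item stmt-BirchSwinnertonDyer-23599), line `rtt_w3` —
# the PARTNER-side analytic layer law over `𝒪` (brick AN_g of ENG / ENG_T2), part 3: the DEPLETED law at every prime —
# `λ_n(θ^{S₀}_n(g)^ι) = deg ω_n^{−ε} + d(L^ε) + Σ_{v∈S₀} p^{v_p(f_ℓ)}·λ(P_{g,ℓ}(ℓ⁻¹(X+1)))`, `μ_n(θ^{S₀}_n(g)^ι) = μ(L^ε)`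

Width seat `bsd-line-slh-p3-w3` g12 under LEAD `cruxlead-stmt-BirchSwinnertonDyer-23599` (cell `bsd-ssimc`); ROUTE-INDEPENDENT
helper (`--supports stmt-BirchSwinnertonDyer-23599`); THEOREMS ONLY — no definition, no named fact, no `sorry`; closes nothing;
BSD is not proved by any of this.

WHAT. AN_g = the analytic third (M4) of the registered engine stub ENG / ENG_T2 of line `rtt_w3` (LEAD census CENSUS-Klam2-g0 §2),
the `𝒪`-coefficient twin of the LANDED rational stub AN_W `SmallImageRttLayerLaw.stub_layerLambdaDepleted_ns` (p744056): for a
weight-2 newform `g` on `Γ₀(M)` (`IsNewform0 g`: `a_ℓ(g)` algebraic integers), an embedding `ι : K_g → ℚ̄_p`, a period `Ω`,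
a Pollack pair `(L⁺, L⁻) ∈ 𝒪⟦T⟧²` over `𝒪 = 𝒪_{ℚ_p(ι K_g)}` (`IsPollackPairK g ι Ω L⁺ L⁻`), a sign `ε`, the norm-`λ` datum `d` of
`L^ε` (Gauss norm `s` first attained at `d`), and a finite set `S₀` of places `≠ p`: at every layer `n` of the parity of `ε` past the
Frobenius thresholds (`n > v_p(f_ℓ)`, `v ∈ S₀`) and inside the headroom, the `S₀`-DEPLETED Mazur–Tate element of the crux's stubs,

  `θ^{S₀}_n(g)^ι = (θ_n(g)^ι · ∏_{v∈S₀} P_{g,ℓ}(ℓ⁻¹(X+1)^{e_{v,n}})) mod ((X+1)^{pⁿ} − 1)`   (VERBATIM the `g`-side term of Kan₂ / ENG),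

has sup norm `s` (so layer-`μ = μ(L^ε)`; `= 0` under unit content) and

  `λ_n(θ^{S₀}_n(g)^ι) = deg ω_n^{−ε} + d + Σ_{v∈S₀} p^{v_p(f_ℓ)} · λ(P_{g,ℓ}(ℓ⁻¹(X+1)))`

— Pollack–Weston's `q_n + λ(L^ε_g) + Σ_v s_ℓ d_ℓ(g)` (Thm. 4.1 with Greenberg–Vatsal's (9)/(2.4) for the partner), every prime `p`,
both parities, no residue field of `ℚ̄_p` in the statement. Parts 1–2: `…RttLayerLawUndepletedK` (core), `…RttEulerLayerK` (Euler side).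

* `supNorm_and_layerLambda_depletedK_of_isPollackPairK` — at ONE layer (parity, thresholds, headroom explicit).
* `eventually_layerLambda_depletedK_of_isPollackPairK` — the `∃ n₀` form
  (`n₀ = Σ_{v∈S₀}(v_p(f_ℓ)+1) + 2(d + Σ) + 2`).
* `eventually_layerLambda_depletedK_of_hasUnitContent` — the same from UNIT CONTENT of `L^ε` (`μ(L^ε_g) = 0`): `∃ d` with
  `‖L^ε_d‖ = 1` and the law, the shape in which ENG_T2's proof consumes AN_g (`λ(L^ε_g) := d` then enters (M3^≥)/(M2)).

References: [Pollack2003] Prop. 6.18; [PollackWeston2011MT] §3.1, Thm. 4.1; [GreenbergVatsal2000] §1 (9), §2 Prop. (2.4);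
[Shimura1971] Thm. 3.48.
-/

set_option autoImplicit false
-- D-0017: single-problem summit, the namespace repeats the problem name by design.
set_option linter.dupNamespace false
noncomputable section

open scoped Classical MatrixGroups ModularForm

open Polynomial NumberField IsDedekindDomain Literature.NumberTheory.EllipticCurves
  Literature.NumberTheory.EllipticCurves.ModularForms Literature.NumberTheory.EllipticCurves.GreenbergVatsal2000
  Literature.NumberTheory.IwasawaTheory Rat.HeightOneSpectrum
  Summit.BirchSwinnertonDyer.Rank1Residual.X2.EulerFactorInvariants
  Summit.BirchSwinnertonDyer.BirchSwinnertonDyer.Theorems.ThetaLayerLambdaCongruenceAtTwo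
  Summit.BirchSwinnertonDyer.BirchSwinnertonDyer.Theorems.ResidualThetaLayer
  Summit.BirchSwinnertonDyer.BirchSwinnertonDyer.Theorems.SmallImageRttOneSided

namespace Summit.BirchSwinnertonDyer.BirchSwinnertonDyer.Theorems.SmallImageRttLayerLawK

/-- A finite product of polynomials of sup norm `1` over a normed field has sup norm `1` (Gauss's lemma). [cite: PollackWeston2011MT, §3.1] -/
theorem supNorm_prod_eq_one {K : Type*} [NormedField K] [IsUltrametricDist K] {ι' : Type*} (s : Finset ι')
    (F : ι' → K[X]) (h : ∀ i ∈ s, (F i).supNorm = 1) : (∏ i ∈ s, F i).supNorm = 1 := by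
  classical
  induction s using Finset.induction_on with
  | empty => rw [Finset.prod_empty, ← C_1, supNorm_C, norm_one]
  | insert a s ha ih =>
    rw [Finset.prod_insert ha, supNorm_mul', h a (Finset.mem_insert_self a s),
      ih fun i hi ↦ h i (Finset.mem_insert_of_mem hi), one_mul]

variable {p : ℕ} [hp : Fact p.Prime] {M : ℕ} [NeZero M] (g : CuspForm (CongruenceSubgroup.Gamma0 M) 2)
  (ι : coeffField g →+* PadicAlgCl p) (Ω : ℂ)

/-- **AN_g at one layer from ONE congruence: sup norm and layer-`λ` of the `S₀`-depleted Mazur–Tate element of the partner.**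
For a newform `g` (`IsNewform0 g`: `‖ι a_ℓ(g)‖ ≤ 1`), `ι`, `Ω`, a sign `ε`, a layer `n` with a congruence
`θ_n(g)^ι ≡ (−1)^{⌊n/2⌋+1} ω_n^{−ε}·L (mod ω_n)` in `𝒪⟦T⟧ ⊗ ℚ` (`IsCongrModOmegaO`; e.g. from a Pollack pair over `𝒪`, or from the
tree's construction `ResidualThetaLayer.exists_isCongrModOmegaO_even/odd` at a cohomological period), a norm-`λ` datum `d` of `L`
with positive Gauss norm `s = ‖L_d‖`, a finite set `S₀` of places `≠ p` with `n > v_p(f_ℓ)` on `S₀`, and the headroom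
`deg ω_n^{−ε} + d + Σ_{v∈S₀} p^{v_p(f_ℓ)}·λ(P_{g,ℓ}(ℓ⁻¹(X+1))) < pⁿ`:
`‖θ^{S₀}_n(g)^ι‖_sup = s` and `λ_n(θ^{S₀}_n(g)^ι) = deg ω_n^{−ε} + d + Σ_{v∈S₀} p^{v_p(f_ℓ)}·λ(P_{g,ℓ}(ℓ⁻¹(X+1)))`.
[cite: Pollack2003, Prop. 6.18] [cite: PollackWeston2011MT, §3.1 and Thm. 4.1] [cite: GreenbergVatsal2000, §2 Prop. (2.4) and §1 (9)] -/
theorem supNorm_and_layerLambda_depletedK_of_isCongrModOmegaO (hnew : IsNewform0 g) (ε : ℤˣ) {n : ℕ}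
    {L : IwasawaAlgebraO (Set.range ι)}
    (hcong : IsCongrModOmegaO (Set.range ι) n ((mazurTateElementK g Ω p n).map ι)
      (((((-1) ^ (n / 2 + 1) * (if ε = 1 then cyclotomicOmegaMinus p n else cyclotomicOmegaPlus p n)).map
          (Int.castRingHom (PadicAlgCl p)) : (PadicAlgCl p)[X]) : PowerSeries (PadicAlgCl p)) *
        iwasawaOToPowerSeries (Set.range ι) L))
    {d : ℕ} (hs : 0 < ‖PowerSeries.coeff d (iwasawaOToPowerSeries (Set.range ι) L)‖)
    (hd1 : ∀ k : ℕ, ‖PowerSeries.coeff k (iwasawaOToPowerSeries (Set.range ι) L)‖ ≤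
      ‖PowerSeries.coeff d (iwasawaOToPowerSeries (Set.range ι) L)‖)
    (hd2 : ∀ k : ℕ, k < d →
      ‖PowerSeries.coeff k (iwasawaOToPowerSeries (Set.range ι) L)‖ <
        ‖PowerSeries.coeff d (iwasawaOToPowerSeries (Set.range ι) L)‖)
    (S₀ : Finset (HeightOneSpectrum (𝓞 ℚ))) (hS : ∀ v ∈ S₀, natGenerator v ≠ p)
    (hfrob : ∀ v ∈ S₀, (frobeniusExponent p (natGenerator v : ℤ_[p])).valuation < n)
    (hroom : (if ε = 1 then cyclotomicOmegaMinus p n else cyclotomicOmegaPlus p n).natDegree + d +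
      ∑ v ∈ S₀, p ^ (frobeniusExponent p (natGenerator v : ℤ_[p])).valuation *
          layerLambda ((1 - C (embCoeff g ι (natGenerator v)) * X +
            (if natGenerator v ∣ M then 0 else C (natGenerator v : PadicAlgCl p)) * X ^ 2).comp
              (C ((natGenerator v : PadicAlgCl p)⁻¹) * (X + 1))) < p ^ n) :
    (((mazurTateElementK g Ω p n).map ι *
        ∏ v ∈ S₀, (1 - C (embCoeff g ι (natGenerator v)) * X +
          (if natGenerator v ∣ M then 0 else C (natGenerator v : PadicAlgCl p)) * X ^ 2).comp
            (C ((natGenerator v : PadicAlgCl p)⁻¹) *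
              (X + 1) ^ (PadicInt.toZModPow n (-(frobeniusExponent p (natGenerator v : ℤ_[p])))).val)) %ₘ
        ((X + 1) ^ p ^ n - 1)).supNorm =
        ‖PowerSeries.coeff d (iwasawaOToPowerSeries (Set.range ι) L)‖ ∧
    layerLambda (((mazurTateElementK g Ω p n).map ι *
        ∏ v ∈ S₀, (1 - C (embCoeff g ι (natGenerator v)) * X +
          (if natGenerator v ∣ M then 0 else C (natGenerator v : PadicAlgCl p)) * X ^ 2).comp
            (C ((natGenerator v : PadicAlgCl p)⁻¹) *
              (X + 1) ^ (PadicInt.toZModPow n (-(frobeniusExponent p (natGenerator v : ℤ_[p])))).val)) %ₘ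
        ((X + 1) ^ p ^ n - 1)) =
      (if ε = 1 then cyclotomicOmegaMinus p n else cyclotomicOmegaPlus p n).natDegree + d +
        ∑ v ∈ S₀, p ^ (frobeniusExponent p (natGenerator v : ℤ_[p])).valuation *
          layerLambda ((1 - C (embCoeff g ι (natGenerator v)) * X +
            (if natGenerator v ∣ M then 0 else C (natGenerator v : PadicAlgCl p)) * X ^ 2).comp
              (C ((natGenerator v : PadicAlgCl p)⁻¹) * (X + 1))) := by
  -- (1) the Mazur–Tate side (part 1, congruence form)
  obtain ⟨hθsup, hθlam⟩ := supNorm_eq_and_layerLambda_mazurTateElementK_of_isCongrModOmegaO g ι Ω ε hcong hs hd1 hd2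
    (by omega)
  have hθne : (mazurTateElementK g Ω p n).map ι ≠ 0 := fun h0 ↦ by
    rw [h0, supNorm_zero] at hθsup
    exact hs.ne hθsup
  -- (2) the Euler side (part 2)
  obtain ⟨hEne, hElam⟩ := layerEulerProductK (p := p) M S₀ hS (fun v ↦ embCoeff g ι (natGenerator v))
    (fun v _ ↦ norm_embCoeff_le_one hnew ι _) hfrob
  have hEsup1 : (∏ v ∈ S₀, (1 - C (embCoeff g ι (natGenerator v)) * X +
          (if natGenerator v ∣ M then 0 else C (natGenerator v : PadicAlgCl p)) * X ^ 2).comp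
            (C ((natGenerator v : PadicAlgCl p)⁻¹) *
              (X + 1) ^ (PadicInt.toZModPow n (-(frobeniusExponent p (natGenerator v : ℤ_[p])))).val)).supNorm = 1 :=
    supNorm_prod_eq_one S₀ _ fun v hv ↦ (layerEulerFactorK (p := p) M v (embCoeff g ι (natGenerator v)) (hS v hv)
      (norm_embCoeff_le_one hnew ι _) (hfrob v hv)).2.1
  -- (3) product and reduction modulo `ω_n`
  obtain ⟨hlam, hsup⟩ := layerLambda_mul_modByMonic_layerModulus (p := p) n hθne hEne (by rw [hθlam, hElam]; omega)
  exact ⟨by rw [hsup, hθsup, hEsup1, mul_one], by rw [hlam, hθlam, hElam]⟩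

/-- **AN_g at one layer for a Pollack pair over `𝒪`.** As `supNorm_and_layerLambda_depletedK_of_isCongrModOmegaO`, with the
congruence at the layer `n` of the parity of `ε` (`Even n ↔ ε = 1`) taken from `IsPollackPairK g ι Ω L⁺ L⁻` and
`L = L^ε = kobayashiLK ε L⁺ L⁻` (non-zero, so its Gauss norm is positive).
[cite: Pollack2003, Prop. 6.18] [cite: PollackWeston2011MT, §3.1 and Thm. 4.1] [cite: GreenbergVatsal2000, §2 Prop. (2.4) and §1 (9)] -/
theorem supNorm_and_layerLambda_depletedK_of_isPollackPairK (hnew : IsNewform0 g)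
    {Lplus Lminus : IwasawaAlgebraO (Set.range ι)} (hPK : IsPollackPairK g ι Ω Lplus Lminus) (ε : ℤˣ) {d : ℕ}
    (hd1 : ∀ k : ℕ, ‖PowerSeries.coeff k (iwasawaOToPowerSeries (Set.range ι) (kobayashiLK ε Lplus Lminus))‖ ≤
      ‖PowerSeries.coeff d (iwasawaOToPowerSeries (Set.range ι) (kobayashiLK ε Lplus Lminus))‖)
    (hd2 : ∀ k : ℕ, k < d →
      ‖PowerSeries.coeff k (iwasawaOToPowerSeries (Set.range ι) (kobayashiLK ε Lplus Lminus))‖ <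
        ‖PowerSeries.coeff d (iwasawaOToPowerSeries (Set.range ι) (kobayashiLK ε Lplus Lminus))‖)
    (S₀ : Finset (HeightOneSpectrum (𝓞 ℚ))) (hS : ∀ v ∈ S₀, natGenerator v ≠ p) {n : ℕ} (hpar : Even n ↔ ε = 1)
    (hfrob : ∀ v ∈ S₀, (frobeniusExponent p (natGenerator v : ℤ_[p])).valuation < n)
    (hroom : (if ε = 1 then cyclotomicOmegaMinus p n else cyclotomicOmegaPlus p n).natDegree + d +
      ∑ v ∈ S₀, p ^ (frobeniusExponent p (natGenerator v : ℤ_[p])).valuation *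
          layerLambda ((1 - C (embCoeff g ι (natGenerator v)) * X +
            (if natGenerator v ∣ M then 0 else C (natGenerator v : PadicAlgCl p)) * X ^ 2).comp
              (C ((natGenerator v : PadicAlgCl p)⁻¹) * (X + 1))) < p ^ n) :
    (((mazurTateElementK g Ω p n).map ι *
        ∏ v ∈ S₀, (1 - C (embCoeff g ι (natGenerator v)) * X +
          (if natGenerator v ∣ M then 0 else C (natGenerator v : PadicAlgCl p)) * X ^ 2).comp
            (C ((natGenerator v : PadicAlgCl p)⁻¹) *
              (X + 1) ^ (PadicInt.toZModPow n (-(frobeniusExponent p (natGenerator v : ℤ_[p])))).val)) %ₘ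
        ((X + 1) ^ p ^ n - 1)).supNorm =
        ‖PowerSeries.coeff d (iwasawaOToPowerSeries (Set.range ι) (kobayashiLK ε Lplus Lminus))‖ ∧
    layerLambda (((mazurTateElementK g Ω p n).map ι *
        ∏ v ∈ S₀, (1 - C (embCoeff g ι (natGenerator v)) * X +
          (if natGenerator v ∣ M then 0 else C (natGenerator v : PadicAlgCl p)) * X ^ 2).comp
            (C ((natGenerator v : PadicAlgCl p)⁻¹) *
              (X + 1) ^ (PadicInt.toZModPow n (-(frobeniusExponent p (natGenerator v : ℤ_[p])))).val)) %ₘ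
        ((X + 1) ^ p ^ n - 1)) =
      (if ε = 1 then cyclotomicOmegaMinus p n else cyclotomicOmegaPlus p n).natDegree + d +
        ∑ v ∈ S₀, p ^ (frobeniusExponent p (natGenerator v : ℤ_[p])).valuation *
          layerLambda ((1 - C (embCoeff g ι (natGenerator v)) * X +
            (if natGenerator v ∣ M then 0 else C (natGenerator v : PadicAlgCl p)) * X ^ 2).comp
              (C ((natGenerator v : PadicAlgCl p)⁻¹) * (X + 1))) := by
  -- the congruence at the layer `n` of the parity of `ε`
  have hcong : IsCongrModOmegaO (Set.range ι) n ((mazurTateElementK g Ω p n).map ι)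
      (((((-1) ^ (n / 2 + 1) * (if ε = 1 then cyclotomicOmegaMinus p n else cyclotomicOmegaPlus p n)).map
          (Int.castRingHom (PadicAlgCl p)) : (PadicAlgCl p)[X]) : PowerSeries (PadicAlgCl p)) *
        iwasawaOToPowerSeries (Set.range ι) (kobayashiLK ε Lplus Lminus)) := by
    rcases Int.units_eq_one_or ε with rfl | rfl
    · simp only [if_true, kobayashiLK_one]
      exact hPK.2.2.2 n (hpar.mpr rfl)
    · have hne : (-1 : ℤˣ) ≠ 1 := by decide
      simp only [hne, if_false, kobayashiLK_neg_one]
      exact hPK.2.2.1 n (Nat.not_even_iff_odd.mp fun h ↦ hne (hpar.mp h))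
  -- `L^ε ≠ 0`, so its Gauss norm is positive
  have hLne : kobayashiLK ε Lplus Lminus ≠ 0 := by
    rcases Int.units_eq_one_or ε with rfl | rfl
    · rw [kobayashiLK_one]; exact hPK.2.1
    · rw [kobayashiLK_neg_one]; exact hPK.1
  have hs : 0 < ‖PowerSeries.coeff d (iwasawaOToPowerSeries (Set.range ι) (kobayashiLK ε Lplus Lminus))‖ := by
    obtain ⟨k, hk⟩ : ∃ k, PowerSeries.coeff k (iwasawaOToPowerSeries (Set.range ι) (kobayashiLK ε Lplus Lminus)) ≠ 0 := by
      by_contra h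
      push Not at h
      apply hLne
      apply iwasawaOToPowerSeries_injective (Set.range ι)
      rw [map_zero]
      exact PowerSeries.ext fun k ↦ by rw [h k, map_zero]
    exact (norm_pos_iff.mpr hk).trans_le (hd1 k)
  exact supNorm_and_layerLambda_depletedK_of_isCongrModOmegaO g ι Ω hnew ε hcong hs hd1 hd2 S₀ hS hfrob hroom

/-- **AN_g from a congruence family, eventually.** With `n₀ = Σ_{v∈S₀}(v_p(f_ℓ) + 1) + 2(d + Σ_{v∈S₀} p^{v_p(f_ℓ)}·λ(P_{g,ℓ}(ℓ⁻¹(X+1)))) + 2`: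
if the congruences `θ_n(g)^ι ≡ (−1)^{⌊n/2⌋+1} ω_n^{−ε}·L (mod ω_n)` hold at every layer `n` of the parity of `ε` (e.g.
`ResidualThetaLayer.exists_isCongrModOmegaO_even/odd`), then for every such `n ≥ n₀`, `‖θ^{S₀}_n(g)^ι‖_sup = ‖L_d‖` and
`λ_n(θ^{S₀}_n(g)^ι) = deg ω_n^{−ε} + d + Σ_{v∈S₀} p^{v_p(f_ℓ)}·λ(P_{g,ℓ}(ℓ⁻¹(X+1)))`. `S₀` in the crux's spelling `(p) ∉ v`.
[cite: Pollack2003, Prop. 6.18] [cite: PollackWeston2011MT, Thm. 4.1] [cite: GreenbergVatsal2000, §2 Prop. (2.4) and §1 (9)] -/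
theorem eventually_layerLambda_depletedK_of_isCongrModOmegaO (hnew : IsNewform0 g) (ε : ℤˣ)
    {L : IwasawaAlgebraO (Set.range ι)}
    (hcong : ∀ n : ℕ, (Even n ↔ ε = 1) → IsCongrModOmegaO (Set.range ι) n ((mazurTateElementK g Ω p n).map ι)
      (((((-1) ^ (n / 2 + 1) * (if ε = 1 then cyclotomicOmegaMinus p n else cyclotomicOmegaPlus p n)).map
          (Int.castRingHom (PadicAlgCl p)) : (PadicAlgCl p)[X]) : PowerSeries (PadicAlgCl p)) *
        iwasawaOToPowerSeries (Set.range ι) L))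
    {d : ℕ} (hs : 0 < ‖PowerSeries.coeff d (iwasawaOToPowerSeries (Set.range ι) L)‖)
    (hd1 : ∀ k : ℕ, ‖PowerSeries.coeff k (iwasawaOToPowerSeries (Set.range ι) L)‖ ≤
      ‖PowerSeries.coeff d (iwasawaOToPowerSeries (Set.range ι) L)‖)
    (hd2 : ∀ k : ℕ, k < d →
      ‖PowerSeries.coeff k (iwasawaOToPowerSeries (Set.range ι) L)‖ <
        ‖PowerSeries.coeff d (iwasawaOToPowerSeries (Set.range ι) L)‖)
    (S₀ : Finset (HeightOneSpectrum (𝓞 ℚ))) (hS₀ : ∀ v ∈ S₀, ((p : ℕ) : 𝓞 ℚ) ∉ v.asIdeal) :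
    ∃ n₀ : ℕ, ∀ n ≥ n₀, (Even n ↔ ε = 1) →
      (((mazurTateElementK g Ω p n).map ι *
        ∏ v ∈ S₀, (1 - C (embCoeff g ι (natGenerator v)) * X +
          (if natGenerator v ∣ M then 0 else C (natGenerator v : PadicAlgCl p)) * X ^ 2).comp
            (C ((natGenerator v : PadicAlgCl p)⁻¹) *
              (X + 1) ^ (PadicInt.toZModPow n (-(frobeniusExponent p (natGenerator v : ℤ_[p])))).val)) %ₘ
        ((X + 1) ^ p ^ n - 1)).supNorm =
          ‖PowerSeries.coeff d (iwasawaOToPowerSeries (Set.range ι) L)‖ ∧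
      layerLambda (((mazurTateElementK g Ω p n).map ι *
        ∏ v ∈ S₀, (1 - C (embCoeff g ι (natGenerator v)) * X +
          (if natGenerator v ∣ M then 0 else C (natGenerator v : PadicAlgCl p)) * X ^ 2).comp
            (C ((natGenerator v : PadicAlgCl p)⁻¹) *
              (X + 1) ^ (PadicInt.toZModPow n (-(frobeniusExponent p (natGenerator v : ℤ_[p])))).val)) %ₘ
        ((X + 1) ^ p ^ n - 1)) =
        (if ε = 1 then cyclotomicOmegaMinus p n else cyclotomicOmegaPlus p n).natDegree + d +
          ∑ v ∈ S₀, p ^ (frobeniusExponent p (natGenerator v : ℤ_[p])).valuation *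
          layerLambda ((1 - C (embCoeff g ι (natGenerator v)) * X +
            (if natGenerator v ∣ M then 0 else C (natGenerator v : PadicAlgCl p)) * X ^ 2).comp
              (C ((natGenerator v : PadicAlgCl p)⁻¹) * (X + 1))) := by
  have hS : ∀ v ∈ S₀, natGenerator v ≠ p := fun v hv ↦ natGenerator_ne_of_natCast_not_mem v (hS₀ v hv)
  set t : HeightOneSpectrum (𝓞 ℚ) → ℕ := fun v ↦ (frobeniusExponent p (natGenerator v : ℤ_[p])).valuation with ht
  set B : ℕ := d + ∑ v ∈ S₀, p ^ (frobeniusExponent p (natGenerator v : ℤ_[p])).valuation *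
    layerLambda ((1 - C (embCoeff g ι (natGenerator v)) * X +
      (if natGenerator v ∣ M then 0 else C (natGenerator v : PadicAlgCl p)) * X ^ 2).comp
        (C ((natGenerator v : PadicAlgCl p)⁻¹) * (X + 1))) with hB
  refine ⟨(∑ v ∈ S₀, (t v + 1)) + (2 * B + 2), fun n hn hpar ↦ ?_⟩
  have htn : ∀ v ∈ S₀, t v < n := fun v hv ↦ by
    have := Finset.single_le_sum (f := fun w ↦ t w + 1) (fun _ _ ↦ Nat.zero_le _) hv
    omega
  have hroom := natDegree_omega_add_lt_pow (p := p) (B := B) (n := n) (by omega) ε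
  exact supNorm_and_layerLambda_depletedK_of_isCongrModOmegaO g ι Ω hnew ε (hcong n hpar) hs hd1 hd2 S₀ hS htn
    (by rw [hB] at hroom; omega)

/-- **AN_g for a Pollack pair over `𝒪`, eventually** (same threshold, with `L = L^ε = kobayashiLK ε L⁺ L⁻`).
[cite: Pollack2003, Prop. 6.18] [cite: PollackWeston2011MT, Thm. 4.1] [cite: GreenbergVatsal2000, §2 Prop. (2.4) and §1 (9)] -/
theorem eventually_layerLambda_depletedK_of_isPollackPairK (hnew : IsNewform0 g)
    {Lplus Lminus : IwasawaAlgebraO (Set.range ι)} (hPK : IsPollackPairK g ι Ω Lplus Lminus) (ε : ℤˣ) {d : ℕ}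
    (hd1 : ∀ k : ℕ, ‖PowerSeries.coeff k (iwasawaOToPowerSeries (Set.range ι) (kobayashiLK ε Lplus Lminus))‖ ≤
      ‖PowerSeries.coeff d (iwasawaOToPowerSeries (Set.range ι) (kobayashiLK ε Lplus Lminus))‖)
    (hd2 : ∀ k : ℕ, k < d →
      ‖PowerSeries.coeff k (iwasawaOToPowerSeries (Set.range ι) (kobayashiLK ε Lplus Lminus))‖ <
        ‖PowerSeries.coeff d (iwasawaOToPowerSeries (Set.range ι) (kobayashiLK ε Lplus Lminus))‖)
    (S₀ : Finset (HeightOneSpectrum (𝓞 ℚ))) (hS₀ : ∀ v ∈ S₀, ((p : ℕ) : 𝓞 ℚ) ∉ v.asIdeal) :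
    ∃ n₀ : ℕ, ∀ n ≥ n₀, (Even n ↔ ε = 1) →
      (((mazurTateElementK g Ω p n).map ι *
        ∏ v ∈ S₀, (1 - C (embCoeff g ι (natGenerator v)) * X +
          (if natGenerator v ∣ M then 0 else C (natGenerator v : PadicAlgCl p)) * X ^ 2).comp
            (C ((natGenerator v : PadicAlgCl p)⁻¹) *
              (X + 1) ^ (PadicInt.toZModPow n (-(frobeniusExponent p (natGenerator v : ℤ_[p])))).val)) %ₘ
        ((X + 1) ^ p ^ n - 1)).supNorm =
          ‖PowerSeries.coeff d (iwasawaOToPowerSeries (Set.range ι) (kobayashiLK ε Lplus Lminus))‖ ∧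
      layerLambda (((mazurTateElementK g Ω p n).map ι *
        ∏ v ∈ S₀, (1 - C (embCoeff g ι (natGenerator v)) * X +
          (if natGenerator v ∣ M then 0 else C (natGenerator v : PadicAlgCl p)) * X ^ 2).comp
            (C ((natGenerator v : PadicAlgCl p)⁻¹) *
              (X + 1) ^ (PadicInt.toZModPow n (-(frobeniusExponent p (natGenerator v : ℤ_[p])))).val)) %ₘ
        ((X + 1) ^ p ^ n - 1)) =
        (if ε = 1 then cyclotomicOmegaMinus p n else cyclotomicOmegaPlus p n).natDegree + d +
          ∑ v ∈ S₀, p ^ (frobeniusExponent p (natGenerator v : ℤ_[p])).valuation *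
          layerLambda ((1 - C (embCoeff g ι (natGenerator v)) * X +
            (if natGenerator v ∣ M then 0 else C (natGenerator v : PadicAlgCl p)) * X ^ 2).comp
              (C ((natGenerator v : PadicAlgCl p)⁻¹) * (X + 1))) := by
  have hS : ∀ v ∈ S₀, natGenerator v ≠ p := fun v hv ↦ natGenerator_ne_of_natCast_not_mem v (hS₀ v hv)
  set t : HeightOneSpectrum (𝓞 ℚ) → ℕ := fun v ↦ (frobeniusExponent p (natGenerator v : ℤ_[p])).valuation with ht
  set B : ℕ := d + ∑ v ∈ S₀, p ^ (frobeniusExponent p (natGenerator v : ℤ_[p])).valuation *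
    layerLambda ((1 - C (embCoeff g ι (natGenerator v)) * X +
      (if natGenerator v ∣ M then 0 else C (natGenerator v : PadicAlgCl p)) * X ^ 2).comp
        (C ((natGenerator v : PadicAlgCl p)⁻¹) * (X + 1))) with hB
  refine ⟨(∑ v ∈ S₀, (t v + 1)) + (2 * B + 2), fun n hn hpar ↦ ?_⟩
  have htn : ∀ v ∈ S₀, t v < n := fun v hv ↦ by
    have := Finset.single_le_sum (f := fun w ↦ t w + 1) (fun _ _ ↦ Nat.zero_le _) hv
    omega
  have hroom := natDegree_omega_add_lt_pow (p := p) (B := B) (n := n) (by omega) ε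
  exact supNorm_and_layerLambda_depletedK_of_isPollackPairK g ι Ω hnew hPK ε hd1 hd2 S₀ hS hpar htn
    (by rw [hB] at hroom; omega)

/-- **AN_g from unit content (`μ(L^ε_g) = 0`), eventually** — the shape consumed by the engine ENG_T2 of line `rtt_w3`: if the
congruences `θ_n(g)^ι ≡ (−1)^{⌊n/2⌋+1} ω_n^{−ε}·L (mod ω_n)` hold at the layers of the parity of `ε` for some `L ∈ 𝒪⟦T⟧` of UNIT
CONTENT, then there is an index `d` (the `λ`-invariant of `L`: `‖L_d‖ = 1`, `‖L_k‖ < 1` for `k < d`) and `n₀` such that for every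
`n ≥ n₀` of that parity the `S₀`-depleted Mazur–Tate element of the partner has sup norm `1` (layer-`μ = 0`) and
`λ_n(θ^{S₀}_n(g)^ι) = deg ω_n^{−ε} + d + Σ_{v∈S₀} p^{v_p(f_ℓ)}·λ(P_{g,ℓ}(ℓ⁻¹(X+1)))`.
[cite: Pollack2003, Prop. 6.18] [cite: PollackWeston2011MT, §3.1 and Thm. 4.1] [cite: GreenbergVatsal2000, §2 Prop. (2.4) and §1 (9)] -/
theorem eventually_layerLambda_depletedK_of_hasUnitContent (hnew : IsNewform0 g) (ε : ℤˣ)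
    {L : IwasawaAlgebraO (Set.range ι)}
    (hcong : ∀ n : ℕ, (Even n ↔ ε = 1) → IsCongrModOmegaO (Set.range ι) n ((mazurTateElementK g Ω p n).map ι)
      (((((-1) ^ (n / 2 + 1) * (if ε = 1 then cyclotomicOmegaMinus p n else cyclotomicOmegaPlus p n)).map
          (Int.castRingHom (PadicAlgCl p)) : (PadicAlgCl p)[X]) : PowerSeries (PadicAlgCl p)) *
        iwasawaOToPowerSeries (Set.range ι) L))
    (hunit : HasUnitContent L)
    (S₀ : Finset (HeightOneSpectrum (𝓞 ℚ))) (hS₀ : ∀ v ∈ S₀, ((p : ℕ) : 𝓞 ℚ) ∉ v.asIdeal) :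
    ∃ d : ℕ, ‖PowerSeries.coeff d (iwasawaOToPowerSeries (Set.range ι) L)‖ = 1 ∧
      (∀ k : ℕ, k < d → ‖PowerSeries.coeff k (iwasawaOToPowerSeries (Set.range ι) L)‖ < 1) ∧
      ∃ n₀ : ℕ, ∀ n ≥ n₀, (Even n ↔ ε = 1) →
        (((mazurTateElementK g Ω p n).map ι *
        ∏ v ∈ S₀, (1 - C (embCoeff g ι (natGenerator v)) * X +
          (if natGenerator v ∣ M then 0 else C (natGenerator v : PadicAlgCl p)) * X ^ 2).comp
            (C ((natGenerator v : PadicAlgCl p)⁻¹) *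
              (X + 1) ^ (PadicInt.toZModPow n (-(frobeniusExponent p (natGenerator v : ℤ_[p])))).val)) %ₘ
        ((X + 1) ^ p ^ n - 1)).supNorm = 1 ∧
        layerLambda (((mazurTateElementK g Ω p n).map ι *
        ∏ v ∈ S₀, (1 - C (embCoeff g ι (natGenerator v)) * X +
          (if natGenerator v ∣ M then 0 else C (natGenerator v : PadicAlgCl p)) * X ^ 2).comp
            (C ((natGenerator v : PadicAlgCl p)⁻¹) *
              (X + 1) ^ (PadicInt.toZModPow n (-(frobeniusExponent p (natGenerator v : ℤ_[p])))).val)) %ₘ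
        ((X + 1) ^ p ^ n - 1)) =
          (if ε = 1 then cyclotomicOmegaMinus p n else cyclotomicOmegaPlus p n).natDegree + d +
            ∑ v ∈ S₀, p ^ (frobeniusExponent p (natGenerator v : ℤ_[p])).valuation *
          layerLambda ((1 - C (embCoeff g ι (natGenerator v)) * X +
            (if natGenerator v ∣ M then 0 else C (natGenerator v : PadicAlgCl p)) * X ^ 2).comp
              (C ((natGenerator v : PadicAlgCl p)⁻¹) * (X + 1))) := by
  obtain ⟨d, hd, hd1, hd2⟩ := exists_normLambda_of_hasUnitContent (p := p) hunit
  obtain ⟨n₀, hn₀⟩ := eventually_layerLambda_depletedK_of_isCongrModOmegaO g ι Ω hnew ε hcong (by rw [hd]; exact one_pos)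
    hd1 hd2 S₀ hS₀
  refine ⟨d, hd, fun k hk ↦ by rw [← hd]; exact hd2 k hk, n₀, fun n hn hpar ↦ ?_⟩
  obtain ⟨h1, h2⟩ := hn₀ n hn hpar
  exact ⟨by rw [h1, hd], h2⟩

end Summit.BirchSwinnertonDyer.BirchSwinnertonDyer.Theorems.SmallImageRttLayerLawK

end
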